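/-
Copyright (c) 2026 the pub-hodgecm-mathlib formalisation cell (harness21).  Prover seat hodgecm-mathlib-LH4-p09 (g9), req620 Track A «(D-RAM) FOUR-FRAME» squad
(STAGE-1b, the (β₂) road, heir LEAD T20-19 (R-36) «RELATIVE SIGNS», β₂-BOARD row (L-S1) «S₁ = ∓2·D₁» (sub-dealer LH4-p04 (g8)); the π template also asked for by
LH4-p16 (g0) ((L-K)) and LH7-p10 (g0) ((L-T))), 2026-09-04.
-/
import Summits.HodgeConjecture.HodgeConjecture.Theorems.F0P3cDyRamToricCensusDefs    -- ★ DEFS leaf (LH4-p12 (g4)): `IsOrd`, `dualGen`, `levelSet`, `levelSetDep`; brings ★ T4 `QuadraticOrder*` (`mul_order_eq_iff`, `mul_mem_order`, `mem_order_mono`)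
import Literature.NumberTheory.LocalFields.QuadraticOrderLatticeClasses              -- ★ T4 (LH4-p12): `exists_addSubgroup_mul_order`, `self_mem_of_mul_order`, `mul_order_eq_iff`, `inv_mem_order_of_v_eq_one`
import HarnessLib

/-!
# Crux `H413`, line LH4 «(D-RAM) FOUR-FRAME» — STAGE-1b, the (β₂) road, (R-36) «RELATIVE SIGNS»: «THE ORDER-COARSENING MAP» — the template `π_{s,c′} : x₀·𝒪_c ↦ (s·x₀)·𝒪_{c′}`
# between cone cells (`|c| ≤ |c′|`: a coarser order; `s` a fixed scalar), its well-definedness, its fibres, and the dual generator ∕ glue unit along it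

Cell `hodgecm-mathlib` (D-0151), FLOOR 0, crux item H413 = `stmt-HodgeConjecture-24833`, route of record `HCCMUnconditional`; squad F0∕P3c∕LH4; lane
`--supports stmt-HodgeConjecture-24833 --as helper` (count-neutral; pays NO tier-0 row).  THEOREMS ONLY (no `def`, no instance, no notation, no `sorry`, default heartbeats).
DATUM-FREE order algebra in the M-letters of ★ DEFS `F0P3cDyRamToricCensusDefs` ∕ ★ T4 `QuadraticOrder*` (`K` with `Valued K ℤᵐ⁰`, `ρ` isometric where said).

WHY (heir LEAD T20-19 (R-36), confirmed on every U row by cdis1 LEDGERCHECK v2 702f2ebb: the β₂ letter is an identity of RELATIVE signed counts between cells — (L-S1)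
`S₁ = ∓2·D₁` «a 2 : 1 map S₁ → D inside literal 1», (L-T) «Hensel-type 2 : 1 maps between consecutive tail cells», (L-K) the RamM twin; the bookkeeping socket is ★ p861465
`F0P3cDyRamCellDiffTransport` (constant-fibre maps), the label socket ★ p861454 `F0P3cDyRamDepthScalar` (relative sign = norm class of the scalar ratio)).  In the cell
coordinates `(j, a)` of ★ DEFS `levelSet` (`Λ = x₀·𝒪_j`, `a` = level of the dual generator `Y = h·N_Θ(x₀)·ϖE^j(α − ρα)`) all these maps are ONE template:
`π_{s,c′}(x₀·𝒪_c) := (s·x₀)·𝒪_{c′}` with `𝒪_c ⊆ 𝒪_{c′}` (`|c| ≤ |c′|`) and a fixed scalar `s` — (L-T): `c = ϖE^{j+1} ↦ c′ = ϖE^j`, `s = ϖE`; (L-S1): `c = ϖE^{j_S} ↦ c′ = ϖE^{j_D}`,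
`s = ϖE^{d−1}` (the level moves by `a ↦ a + v(sΘs) − (j − j′)`).  THIS FILE types the template with NO `def` (the image subgroup `P` enters through its membership description,
★ T4 `exists_addSubgroup_mul_order` supplies it):
* §1 `coarsen_eq_of_presentations` — WELL-DEFINED: two presentations `x₀·𝒪_c = x₀′·𝒪_c` of the same `Λ` give the same `(s·x₀)·𝒪_{c′} = (s·x₀′)·𝒪_{c′}` (★ `mul_order_eq_iff` at `c`,
  `mem_order_mono`, ★ `mul_order_eq_iff` at `c′`); `coarsen_eq_coarsen_iff` — FIBRES: `(s·x₁)·𝒪_{c′} = (s·x₂)·𝒪_{c′}` iff `x₁∕x₂` is a unit of the COARSER order `𝒪_{c′}` (so the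
  fibre of `π` through `x₀·𝒪_c` inside `levelSet(c, ·)` is indexed by `𝒪_{c′}ˣ ∕ 𝒪_cˣ` cut by the cell's clauses — the row supplies the count);
* §2 `dualGen_coarsen` — `Y_{c′}(s·x₀) = (s·Θs)·(c′∕c)·Y_c(x₀)` (so `|Y| ↦ |Y|·|sΘs|·|c′∕c|`: the level shift of the row); `glueUnit` is a function of `(t, b)` with
  `t = h·N_Θ(x₀)∕(Y·ΘY)`: `lineRatio_coarsen` — `t_{c′}(s·x₀) = t_c(x₀) ∕ ((s·Θs)·(c′∕c)·Θ(c′∕c))` — the scalar by which ★ p861454's depth coefficient ∕ the glue unit move along `π`.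
HONEST LABEL.  Count-neutral order algebra; nothing printed is asserted; WHICH `π` realises (L-S1)∕(L-T)∕(L-K) with fibre 2 and which sign it carries is the row's content (data:
F0P3-p01 (g36) PURE-CELL LEDGER 86ca30c7; engine check of `π₁` asked 15:38:08Z) — not claimed here; (β₂) the letter stays UNPROVED; `HC_CM` is proved only modulo the 7 printed
citations (2 remaining named inputs: hLiu418 = `stmt-HodgeConjecture-24832`, h413 = `stmt-HodgeConjecture-24833`) until rung 0 closes.
## References
* [Serre1979] J.-P. Serre, *Local Fields*, GTM 67 (1979): Ch. III §6 Prop. 12 (orders `𝒪_E + c·𝒪_M` of a quadratic extension and their units).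
* [Flicker1998UnitaryFL] Y. Z. Flicker, *Elementary proof of a fundamental lemma for a unitary group*, Canad. J. Math. 50 (1998): p. 84 REMARK (the order-lattice bookkeeping).
* [Kottwitz1986BaseChangeUnits] R. E. Kottwitz, *Base change for unit elements of Hecke algebras*, Compositio Math. 60 (1986): §1 pp. 240–241.
-/

set_option autoImplicit false

namespace Summit.HodgeConjecture.HodgeConjecture.Cruxes.H413.F0P3cDyRamLevelSetCoarsening

open scoped WithZero
open Literature.NumberTheory.LocalFields.QuadraticOrder
open Summit.HodgeConjecture.HodgeConjecture.Cruxes.H413.F0P3cDyRamToricCensusDefs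

variable {K : Type*} [Field K] [Valued K ℤᵐ⁰] {ρ Θ : K →+* K} {α : K}

/-! ## §1 The coarsening `x₀·𝒪_c ↦ (s·x₀)·𝒪_{c′}` is well defined on order lattices; its fibres -/

/-- **UNITS OF `𝒪_c` ARE UNITS OF EVERY COARSER ORDER**: if `x₀·𝒪_c = x₀′·𝒪_c` (both generators non-zero) and `|c| ≤ |c′|`, then `x₀′∕x₀` and `x₀∕x₀′` lie in `𝒪_{c′}`.
[cite: Serre1979, Ch. III §6 Prop. 12] -/
theorem isOrd_div_of_presentations (hvρ : ∀ x, Valued.v (ρ x) = Valued.v x) {c c' x₀ x₀' : K} (hcc : Valued.v c ≤ Valued.v c')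
    (hx₀ : x₀ ≠ 0) (hx₀' : x₀' ≠ 0) {Λ : AddSubgroup K}
    (hΛ : ∀ x, x ∈ Λ ↔ ∃ z, IsOrd ρ α c z ∧ x = x₀ * z) (hΛ' : ∀ x, x ∈ Λ ↔ ∃ z, IsOrd ρ α c z ∧ x = x₀' * z) :
    IsOrd ρ α c' (x₀' / x₀) ∧ IsOrd ρ α c' (x₀ / x₀') := by
  have h := (mul_order_eq_iff (ρ := ρ) (α := α) hvρ hx₀ hx₀' hΛ hΛ').1 rfl
  exact ⟨mem_order_mono hcc h.1, mem_order_mono hcc h.2⟩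

/-- **`π_{s,c′}` IS WELL DEFINED**: two presentations `x₀·𝒪_c = x₀′·𝒪_c` of the same lattice give the same coarsened lattice `(s·x₀)·𝒪_{c′} = (s·x₀′)·𝒪_{c′}` (`|c| ≤ |c′|`,
`s ≠ 0`; the images `P`, `P′` enter through their membership descriptions — ★ `exists_addSubgroup_mul_order` supplies them). [cite: Serre1979, Ch. III §6 Prop. 12] [cite: Flicker1998UnitaryFL, p. 84] -/
theorem coarsen_eq_of_presentations (hvρ : ∀ x, Valued.v (ρ x) = Valued.v x) {c c' s x₀ x₀' : K} (hcc : Valued.v c ≤ Valued.v c')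
    (hs : s ≠ 0) (hx₀ : x₀ ≠ 0) (hx₀' : x₀' ≠ 0) {Λ : AddSubgroup K}
    (hΛ : ∀ x, x ∈ Λ ↔ ∃ z, IsOrd ρ α c z ∧ x = x₀ * z) (hΛ' : ∀ x, x ∈ Λ ↔ ∃ z, IsOrd ρ α c z ∧ x = x₀' * z)
    {P P' : AddSubgroup K}
    (hP : ∀ x, x ∈ P ↔ ∃ z, IsOrd ρ α c' z ∧ x = s * x₀ * z) (hP' : ∀ x, x ∈ P' ↔ ∃ z, IsOrd ρ α c' z ∧ x = s * x₀' * z) :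
    P = P' := by
  obtain ⟨h1, h2⟩ := isOrd_div_of_presentations hvρ hcc hx₀ hx₀' hΛ hΛ'
  refine (mul_order_eq_iff (ρ := ρ) (α := α) hvρ (mul_ne_zero hs hx₀) (mul_ne_zero hs hx₀') hP hP').2 ⟨?_, ?_⟩
  · rw [show s * x₀' / (s * x₀) = x₀' / x₀ by field_simp]; exact h1
  · rw [show s * x₀ / (s * x₀') = x₀ / x₀' by field_simp]; exact h2

/-- **THE FIBRES OF `π_{s,c′}`**: for order lattices `x₁·𝒪_c`, `x₂·𝒪_c` the coarsened lattices agree, `(s·x₁)·𝒪_{c′} = (s·x₂)·𝒪_{c′}`, iff `x₁∕x₂` is a UNIT OF THE COARSER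
ORDER (`x₂∕x₁, x₁∕x₂ ∈ 𝒪_{c′}`) — the fibre through `x₀·𝒪_c` is indexed by `𝒪_{c′}ˣ ∕ 𝒪_cˣ` (cut by whatever cell clauses the row imposes).
[cite: Serre1979, Ch. III §6 Prop. 12] [cite: Flicker1998UnitaryFL, p. 84] -/
theorem coarsen_eq_coarsen_iff (hvρ : ∀ x, Valued.v (ρ x) = Valued.v x) {c' s x₁ x₂ : K} (hs : s ≠ 0) (hx₁ : x₁ ≠ 0) (hx₂ : x₂ ≠ 0)
    {P₁ P₂ : AddSubgroup K}
    (hP₁ : ∀ x, x ∈ P₁ ↔ ∃ z, IsOrd ρ α c' z ∧ x = s * x₁ * z) (hP₂ : ∀ x, x ∈ P₂ ↔ ∃ z, IsOrd ρ α c' z ∧ x = s * x₂ * z) :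
    P₁ = P₂ ↔ IsOrd ρ α c' (x₂ / x₁) ∧ IsOrd ρ α c' (x₁ / x₂) := by
  rw [mul_order_eq_iff (ρ := ρ) (α := α) hvρ (mul_ne_zero hs hx₁) (mul_ne_zero hs hx₂) hP₁ hP₂,
    show s * x₂ / (s * x₁) = x₂ / x₁ by field_simp, show s * x₁ / (s * x₂) = x₁ / x₂ by field_simp]
  exact Iff.rfl

/-- **`π` DOES NOT SEPARATE MORE THAN `𝒪_c`**: if `x₁·𝒪_c = x₂·𝒪_c` then of course the coarsened lattices agree (the map direction of §1). [cite: Serre1979, Ch. III §6 Prop. 12] -/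
theorem coarsen_eq_coarsen_of_eq (hvρ : ∀ x, Valued.v (ρ x) = Valued.v x) {c c' s x₁ x₂ : K} (hcc : Valued.v c ≤ Valued.v c') (hs : s ≠ 0)
    (hx₁ : x₁ ≠ 0) (hx₂ : x₂ ≠ 0) {Λ₁ Λ₂ P₁ P₂ : AddSubgroup K}
    (hΛ₁ : ∀ x, x ∈ Λ₁ ↔ ∃ z, IsOrd ρ α c z ∧ x = x₁ * z) (hΛ₂ : ∀ x, x ∈ Λ₂ ↔ ∃ z, IsOrd ρ α c z ∧ x = x₂ * z)
    (hP₁ : ∀ x, x ∈ P₁ ↔ ∃ z, IsOrd ρ α c' z ∧ x = s * x₁ * z) (hP₂ : ∀ x, x ∈ P₂ ↔ ∃ z, IsOrd ρ α c' z ∧ x = s * x₂ * z) (h : Λ₁ = Λ₂) :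
    P₁ = P₂ := by
  subst h
  exact coarsen_eq_of_presentations hvρ hcc hs hx₁ hx₂ hΛ₁ hΛ₂ hP₁ hP₂

/-! ## §2 The dual generator and the line ratio along `π` -/

omit [Valued K ℤᵐ⁰] in
/-- **THE DUAL GENERATOR ALONG `π`**: `Y_{c′}(s·x₀) = (s·Θs)·(c′·c⁻¹)·Y_c(x₀)` (`c ≠ 0`) — so the LEVEL moves by `v(sΘs) + v(c′) − v(c)` (for (L-T): `s = ϖE`, `c′ = c∕ϖE`:
`+2 − 1 = +1`… read against the row's `a`-bookkeeping). [cite: Kottwitz1986BaseChangeUnits, §1 pp. 240–241] -/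
theorem dualGen_coarsen {c : K} (hc : c ≠ 0) (c' h s x₀ : K) :
    dualGen ρ Θ α c' h (s * x₀) = (s * Θ s) * (c' * c⁻¹) * dualGen ρ Θ α c h x₀ := by
  rw [dualGen_def, dualGen_def, map_mul]
  field_simp

omit [Valued K ℤᵐ⁰] in
/-- **THE LINE RATIO ALONG `π`**: with `t_c(x₀) = h·(x₀Θx₀)∕(Y_c·ΘY_c)`, `Θ` an involution and `λ := (sΘs)·(c′c⁻¹)` the dual-generator multiplier of `dualGen_coarsen`:
`t_{c′}(s·x₀) = t_c(x₀) · (sΘs) ∕ (λ·Θλ)` (`s, c, c′, Y ≠ 0`) — the scalar by which the glue unit `−Tr_ρ(t)·(ϖEΘϖE)^b∕c_U` and ★ p861454's depth data move along `π`.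
[cite: Kottwitz1986BaseChangeUnits, §1 pp. 240–241] -/
theorem lineRatio_coarsen (hΘΘ : ∀ x, Θ (Θ x) = x) {c c' s : K} (hc : c ≠ 0) (hc' : c' ≠ 0) (hs : s ≠ 0) (h : K) {x₀ : K}
    (hY0 : dualGen ρ Θ α c h x₀ ≠ 0) :
    h * (s * x₀ * Θ (s * x₀)) / (dualGen ρ Θ α c' h (s * x₀) * Θ (dualGen ρ Θ α c' h (s * x₀))) =
      (h * (x₀ * Θ x₀) / (dualGen ρ Θ α c h x₀ * Θ (dualGen ρ Θ α c h x₀))) * (s * Θ s) /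
        (((s * Θ s) * (c' * c⁻¹)) * Θ ((s * Θ s) * (c' * c⁻¹))) := by
  have hΘs : Θ s ≠ 0 := (map_ne_zero Θ).2 hs
  have hΘc : Θ c ≠ 0 := (map_ne_zero Θ).2 hc
  have hΘc' : Θ c' ≠ 0 := (map_ne_zero Θ).2 hc'
  have hΘY : Θ (dualGen ρ Θ α c h x₀) ≠ 0 := (map_ne_zero Θ).2 hY0
  rw [dualGen_coarsen hc]
  simp only [map_mul, map_inv₀, hΘΘ]
  field_simp

end Summit.HodgeConjecture.HodgeConjecture.Cruxes.H413.F0P3cDyRamLevelSetCoarsening
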